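import Mathlib

/-!
# Symmetric truncated Stieltjes moment sequences lie in the closed cone of pair sequences

Let `L = 2S+1` and let `s : {0,…,L} → ℝ` be SYMMETRIC (`s_u = s_{L-u}`) with both truncated
Hankel forms non-negative: `Σ_{i,j ≤ S} aᵢ aⱼ s_{i+j} ≥ 0` and `Σ_{i,j ≤ S} aᵢ aⱼ s_{i+j+1} ≥ 0` for
all real `a`. Then `s` belongs to the CLOSED convex cone generated by the "pair sequences"
`p_q(u) = (q^u + q^{L-u})/2`, `q ∈ [0,1]`: for every `ε > 0` there are finitely many `t_k ≥ 0`,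
`q_k ∈ [0,1]` with `|s_u - Σ_k t_k p_{q_k}(u)| ≤ ε` for all `u ≤ L`
(`symmHankel_approx_pairCone`).

This is the cone-duality form of the truncated Stieltjes moment problem on `[0, ∞)` folded by the
symmetry `λ ↦ 1/λ` (the sequences arising from reflection positivity of a translation-invariant
state on the discrete circle `ℤ/L`, cf. the transfer-matrix representation
`s_u = Σ w (x^u y^{L-u} + x^{L-u} y^u)/2`). Proof: if `s ∉ C` (closure of the `ℝ≥0`-span of the
arc), `ProperCone.hyperplane_separation_point` gives a continuous functional `φ ≥ 0` on `C` with
`φ(s) < 0`; the polynomial `P(λ) = Σ_u y'_u λ^u` of the symmetrised coefficient vector of `φ`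
satisfies `P(q) = φ(p_q) ≥ 0` on `[0,1]`, hence on `[0,∞)` (`P(λ) = λ^L P(1/λ)`); the half-line
Positivstellensatz in degree `2S+1` (Pólya–Szegő: `P = Σ fᵢ² + λ Σ gᵢ²`, `deg fᵢ, deg gᵢ ≤ S`,
taken here as an explicit HYPOTHESIS of the main theorem, to be discharged by
`Literature.Algebra.Polynomial.polyaSzego_halfLine`) then gives
`φ(s) = Λ_s(P) = Σ fᵢᵀ H₀ fᵢ + Σ gᵢᵀ H₁ gᵢ ≥ 0`, a contradiction. No definitions are introduced
(the Riesz functional is written out as the finite sum `Σ_{u<D} (coeff Q u) s_u`).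

References: G. Pólya, G. Szegő, *Problems and Theorems in Analysis II*, Part VI §6;
R. Curto, L. Fialkow, *Recursiveness, positivity, and truncated moment problems*, Houston J. Math.
17 (1991), §5 (truncated Stieltjes problem); A. Klein, L. Landau, J. Funct. Anal. 44 (1981) 121
(reflection positivity on the circle). All statements here are proved. [folklore]
-/

open scoped BigOperators NNReal
open Finset Polynomial

namespace Literature.Analysis.Moments

/-! ### The Riesz functional of a truncated sequence -/

/-- The truncated Riesz functional `Λ_s(Q) = Σ_{u<D} (coeff Q u) s_u` is additive. [folklore] -/
theorem riesz_add (s : ℕ → ℝ) (D : ℕ) (Q R : Polynomial ℝ) :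
    ∑ u ∈ range D, (Q + R).coeff u * s u =
      ∑ u ∈ range D, Q.coeff u * s u + ∑ u ∈ range D, R.coeff u * s u := by
  rw [← sum_add_distrib]
  exact sum_congr rfl fun u _ => by rw [coeff_add, add_mul]

/-- The truncated Riesz functional commutes with finite sums. [folklore] -/
theorem riesz_sum (s : ℕ → ℝ) (D : ℕ) {ι : Type*} (T : Finset ι) (Q : ι → Polynomial ℝ) :
    ∑ u ∈ range D, (∑ i ∈ T, Q i).coeff u * s u =
      ∑ i ∈ T, ∑ u ∈ range D, (Q i).coeff u * s u := by
  rw [sum_comm]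
  exact sum_congr rfl fun u _ => by rw [finsetSum_coeff, sum_mul]

/-- The truncated Riesz functional on a monomial below the truncation order. [folklore] -/
theorem riesz_C_mul_X_pow (s : ℕ → ℝ) {D k : ℕ} (hk : k < D) (c : ℝ) :
    ∑ u ∈ range D, (C c * X ^ k).coeff u * s u = c * s k := by
  simp_rw [coeff_C_mul_X_pow]
  rw [sum_eq_single k (fun u _ hu => by simp [hu]) (fun h => absurd (mem_range.2 hk) h)]
  simp

/-- The truncated Riesz functional of `X^e · p · q` for `deg p, deg q ≤ S` and `2S + e < D` is the
Hankel-type double sum `Σ_{a,b ≤ S} p_a q_b s_{a+b+e}`. [folklore] -/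
theorem riesz_X_pow_mul_mul (s : ℕ → ℝ) {D S e : ℕ} (hD : 2 * S + e < D) (p q : Polynomial ℝ)
    (hp : p.natDegree ≤ S) (hq : q.natDegree ≤ S) :
    ∑ u ∈ range D, (X ^ e * (p * q)).coeff u * s u =
      ∑ a ∈ range (S + 1), ∑ b ∈ range (S + 1), p.coeff a * q.coeff b * s (a + b + e) := by
  have hp' := as_sum_range' p (S + 1) (Nat.lt_succ_of_le hp)
  have hq' := as_sum_range' q (S + 1) (Nat.lt_succ_of_le hq)
  have hexp : X ^ e * (p * q) =
      ∑ a ∈ range (S + 1), ∑ b ∈ range (S + 1), C (p.coeff a * q.coeff b) * X ^ (a + b + e) := by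
    conv_lhs => rw [hp', hq']
    rw [sum_mul_sum, mul_sum]
    refine sum_congr rfl fun a _ => ?_
    rw [mul_sum]
    refine sum_congr rfl fun b _ => ?_
    simp only [← C_mul_X_pow_eq_monomial, C_mul]
    ring
  rw [hexp, riesz_sum]
  refine sum_congr rfl fun a ha => ?_
  rw [riesz_sum]
  refine sum_congr rfl fun b hb => ?_
  have hlt : a + b + e < D := by
    have := mem_range.1 ha; have := mem_range.1 hb; omega
  rw [riesz_C_mul_X_pow s hlt]

/-! ### The main theorem -/

/-- **Symmetric truncated Stieltjes sequences are in the closed pair cone** (given, as the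
hypothesis `hPS`, the half-line Positivstellensatz in degree `2S+1`: every real polynomial of
degree `≤ 2S+1` non-negative on `[0,∞)` is `Σᵢ fᵢ² + X Σᵢ gᵢ²` with `deg fᵢ, deg gᵢ ≤ S` —
Pólya–Szegő). For `s` symmetric on `{0,…,2S+1}` with both Hankel forms of order `S` non-negative
and every `ε > 0` there are `t_k ≥ 0`, `q_k ∈ [0,1]` (`k < n`) with
`|s_u - Σ_k t_k (q_k^u + q_k^{2S+1-u})/2| ≤ ε` for all `u ≤ 2S+1`. [folklore] -/
theorem symmHankel_approx_pairCone_of (S : ℕ)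
    (hPS : ∀ P : Polynomial ℝ, P.natDegree ≤ 2 * S + 1 → (∀ x : ℝ, 0 ≤ x → 0 ≤ P.eval x) →
      ∃ (m : ℕ) (f g : ℕ → Polynomial ℝ), (∀ i < m, (f i).natDegree ≤ S ∧ (g i).natDegree ≤ S) ∧
        P = ∑ i ∈ Finset.range m, (f i) ^ 2 + Polynomial.X * ∑ i ∈ Finset.range m, (g i) ^ 2)
    (s : ℕ → ℝ)
    (hsym : ∀ u ≤ 2 * S + 1, s u = s (2 * S + 1 - u))
    (hH0 : ∀ a : ℕ → ℝ, 0 ≤ ∑ i ∈ range (S + 1), ∑ j ∈ range (S + 1), a i * a j * s (i + j))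
    (hH1 : ∀ a : ℕ → ℝ, 0 ≤ ∑ i ∈ range (S + 1), ∑ j ∈ range (S + 1), a i * a j * s (i + j + 1))
    (ε : ℝ) (hε : 0 < ε) :
    ∃ (n : ℕ) (t q : ℕ → ℝ), (∀ k < n, 0 ≤ t k) ∧ (∀ k < n, 0 ≤ q k ∧ q k ≤ 1) ∧
      ∀ u ≤ 2 * S + 1,
        |s u - ∑ k ∈ range n, t k * ((q k ^ u + q k ^ (2 * S + 1 - u)) / 2)| ≤ ε := by
  -- ambient space `E = ℝ^{L+1}` with the sup norm, the arc of pair vectors and its closed cone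
  set L : ℕ := 2 * S + 1 with hL
  let E := Fin (L + 1) → ℝ
  let pv : ℝ → E := fun q u => (q ^ (u : ℕ) + q ^ (L - u)) / 2
  let A : Set E := pv '' Set.Icc 0 1
  let K : Submodule ℝ≥0 E := Submodule.span ℝ≥0 A
  let Ccl : ProperCone ℝ E := K.closure
  let sv : E := fun u => s u
  -- basic facts about the arc and the cone
  have hpv_mem : ∀ q : ℝ, q ∈ Set.Icc (0 : ℝ) 1 → pv q ∈ Ccl := fun q hq =>
    (Submodule.mem_closure_iff).2
      (K.le_topologicalClosure (Submodule.subset_span (Set.mem_image_of_mem pv hq)))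
  -- Step 1: `sv` lies in the closed cone (cone duality + Positivstellensatz)
  have hmem : sv ∈ Ccl := by
    by_contra hnot
    obtain ⟨φ, hφC, hφs⟩ := Ccl.hyperplane_separation_point hnot
    -- coordinates of `φ`
    let yF : Fin (L + 1) → ℝ := fun i => φ (fun j => if i = j then 1 else 0)
    have hφ_apply : ∀ x : E, φ x = ∑ i : Fin (L + 1), x i * yF i := fun x => by
      have h := LinearMap.pi_apply_eq_sum_univ (φ : E →ₗ[ℝ] ℝ) x
      simpa [yF, smul_eq_mul] using h
    let y : ℕ → ℝ := fun u => if h : u < L + 1 then yF ⟨u, h⟩ else 0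
    have hφ_range : ∀ x : ℕ → ℝ,
        φ (fun i : Fin (L + 1) => x i) = ∑ u ∈ range (L + 1), x u * y u := fun x => by
      rw [hφ_apply, ← Fin.sum_univ_eq_sum_range (fun u => x u * y u) (L + 1)]
      refine Finset.sum_congr rfl fun i _ => ?_
      simp only [y, dif_pos i.2, Fin.eta]
    -- `φ` on pair vectors, as a range sum
    have hφ_pv : ∀ x : ℝ,
        φ (pv x) = ∑ u ∈ range (L + 1), (x ^ u + x ^ (L - u)) / 2 * y u := fun x =>
      hφ_range fun u => (x ^ u + x ^ (L - u)) / 2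
    -- symmetrised coefficients and the polynomial `P`
    let y' : ℕ → ℝ := fun u => (y u + y (L - u)) / 2
    have hsymsum : ∀ w : ℕ → ℝ,
        ∑ u ∈ range (L + 1), y (L - u) * w u = ∑ u ∈ range (L + 1), y u * w (L - u) := by
      intro w
      rw [← sum_range_reflect (fun u => y u * w (L - u)) (L + 1)]
      refine sum_congr rfl fun u hu => ?_
      have hu' := mem_range.1 hu
      congr 2; omega
    have hy'_pow : ∀ x : ℝ,
        ∑ u ∈ range (L + 1), y' u * x ^ u = φ (pv x) := by
      intro x
      rw [hφ_pv]
      have h2 := hsymsum fun u => x ^ u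
      have : ∑ u ∈ range (L + 1), y' u * x ^ u =
          (∑ u ∈ range (L + 1), y u * x ^ u + ∑ u ∈ range (L + 1), y (L - u) * x ^ u) / 2 := by
        rw [← sum_add_distrib, Finset.sum_div]
        refine sum_congr rfl fun u _ => ?_
        simp only [y']
        ring
      rw [this, h2, ← sum_add_distrib, Finset.sum_div]
      refine sum_congr rfl fun u _ => ?_
      ring
    let P : Polynomial ℝ := ∑ u ∈ range (L + 1), C (y' u) * X ^ u
    have hPeval : ∀ x : ℝ, P.eval x = φ (pv x) := fun x => by
      rw [← hy'_pow x]
      simp only [P, eval_finsetSum, eval_mul, eval_C, eval_pow, eval_X]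
    have hPdeg : P.natDegree ≤ 2 * S + 1 := by
      refine natDegree_sum_le_of_forall_le _ _ fun u hu => ?_
      exact (natDegree_C_mul_X_pow_le (y' u) u).trans (by have := mem_range.1 hu; omega)
    -- positivity of `P` on `[0, ∞)`
    have hscale : ∀ x : ℝ, 1 < x → pv x = (x ^ L) • pv x⁻¹ := by
      intro x hx
      have hx0 : x ≠ 0 := by positivity
      funext u
      change (x ^ (u : ℕ) + x ^ (L - u)) / 2 = x ^ L * ((x⁻¹ ^ (u : ℕ) + x⁻¹ ^ (L - (u : ℕ))) / 2)
      have hu : (u : ℕ) ≤ L := by have := u.2; omega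
      have e1 : x ^ L * x⁻¹ ^ (u : ℕ) = x ^ (L - u) := by
        rw [show x ^ L = x ^ (L - u) * x ^ (u : ℕ) by rw [← pow_add, Nat.sub_add_cancel hu],
          mul_assoc, ← mul_pow, mul_inv_cancel₀ hx0, one_pow, mul_one]
      have e2 : x ^ L * x⁻¹ ^ (L - u) = x ^ (u : ℕ) := by
        rw [show x ^ L = x ^ (u : ℕ) * x ^ (L - u) by rw [← pow_add, Nat.add_sub_cancel' hu],
          mul_assoc, ← mul_pow, mul_inv_cancel₀ hx0, one_pow, mul_one]
      rw [mul_div_assoc', mul_add, e1, e2, add_comm]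
    have hPpos : ∀ x : ℝ, 0 ≤ x → 0 ≤ P.eval x := by
      intro x hx
      rw [hPeval]
      rcases le_or_gt x 1 with hx1 | hx1
      · exact hφC _ (hpv_mem x ⟨hx, hx1⟩)
      · rw [hscale x hx1, map_smul, smul_eq_mul]
        refine mul_nonneg (by positivity) (hφC _ (hpv_mem _ ⟨by positivity, ?_⟩))
        exact inv_le_one_of_one_le₀ hx1.le
    -- the Positivstellensatz certificate
    obtain ⟨m, f, g, hfg, hP⟩ := hPS P hPdeg hPpos
    -- the Riesz functional of `s` on `P`: once as `φ sv < 0` …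
    have hΛP : ∑ u ∈ range (L + 1), P.coeff u * s u = φ sv := by
      have h1 : ∑ u ∈ range (L + 1), P.coeff u * s u = ∑ v ∈ range (L + 1), y' v * s v := by
        simp only [P]
        rw [riesz_sum]
        refine sum_congr rfl fun v hv => ?_
        exact riesz_C_mul_X_pow s (mem_range.1 hv) (y' v)
      have h2 : ∑ v ∈ range (L + 1), y' v * s v = ∑ v ∈ range (L + 1), y v * s v := by
        have h3 := hsymsum s
        have h4 : ∑ u ∈ range (L + 1), y u * s (L - u) = ∑ u ∈ range (L + 1), y u * s u :=
          sum_congr rfl fun u hu => by rw [← hsym u (by have := mem_range.1 hu; omega)]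
        have : ∑ v ∈ range (L + 1), y' v * s v =
            (∑ v ∈ range (L + 1), y v * s v + ∑ v ∈ range (L + 1), y (L - v) * s v) / 2 := by
          rw [← sum_add_distrib, Finset.sum_div]
          refine sum_congr rfl fun u _ => ?_
          simp only [y']
          ring
        rw [this, h3, h4]
        ring
      have h5 : φ sv = ∑ u ∈ range (L + 1), s u * y u := hφ_range s
      rw [h1, h2, h5]
      exact sum_congr rfl fun u _ => mul_comm _ _
    -- … and once as a sum of Hankel forms `≥ 0`
    have hΛP' : 0 ≤ ∑ u ∈ range (L + 1), P.coeff u * s u := by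
      rw [hP, riesz_add, riesz_sum, mul_sum, riesz_sum]
      refine add_nonneg (sum_nonneg fun i hi => ?_) (sum_nonneg fun i hi => ?_)
      · have hdi := (hfg i (mem_range.1 hi)).1
        have := riesz_X_pow_mul_mul s (D := L + 1) (S := S) (e := 0) (by omega) (f i) (f i) hdi hdi
        rw [pow_zero, one_mul, ← pow_two] at this
        rw [this]
        simpa using hH0 fun a => (f i).coeff a
      · have hdi := (hfg i (mem_range.1 hi)).2
        have := riesz_X_pow_mul_mul s (D := L + 1) (S := S) (e := 1) (by omega) (g i) (g i) hdi hdi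
        rw [pow_one, ← pow_two] at this
        rw [this]
        exact hH1 fun a => (g i).coeff a
    rw [hΛP] at hΛP'
    exact absurd hφs (not_lt.2 hΛP')
  -- Step 2: extract a finite non-negative combination within `ε`
  have hcl : sv ∈ closure (K : Set E) := by
    rw [← Submodule.topologicalClosure_coe]
    exact (Submodule.mem_closure_iff).1 hmem
  obtain ⟨x, hxK, hdist⟩ := Metric.mem_closure_iff.1 hcl ε hε
  obtain ⟨c, T, hTA, -, hsumx⟩ := Submodule.mem_span_iff_exists_finset_subset.1 hxK
  -- choose parameters on the arc
  have hchoose : ∀ a : E, a ∈ A → ∃ q : ℝ, q ∈ Set.Icc (0 : ℝ) 1 ∧ pv q = a :=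
    fun a ha => (Set.mem_image _ _ _).1 ha
  choose! qf hqf using hchoose
  let n : ℕ := T.card
  let eq := T.equivFin
  let t : ℕ → ℝ := fun k => if h : k < n then (c ((eq.symm ⟨k, h⟩ : T) : E) : ℝ) else 0
  let qs : ℕ → ℝ := fun k => if h : k < n then qf ((eq.symm ⟨k, h⟩ : T) : E) else 0
  refine ⟨n, t, qs, fun k hk => by simp [t, hk], fun k hk => ?_, fun u hu => ?_⟩
  · simp only [qs, hk, dite_true]
    exact (hqf _ (hTA (eq.symm ⟨k, hk⟩).2)).1
  · -- the finite combination reproduces `x` at the coordinate `u`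
    have huL : u < L + 1 := by omega
    have hcoord : ∑ k ∈ range n, t k * ((qs k ^ u + qs k ^ (L - u)) / 2) =
        x ⟨u, huL⟩ := by
      rw [← hsumx, ← Fin.sum_univ_eq_sum_range
        (fun k => t k * ((qs k ^ u + qs k ^ (L - u)) / 2)) n]
      rw [Finset.sum_apply, ← Finset.sum_coe_sort T, ← eq.symm.sum_comp]
      refine Fintype.sum_congr _ _ fun k => ?_
      have hk := k.2
      have haA : ((eq.symm k : T) : E) ∈ A := hTA (eq.symm k).2
      have hpa := congrFun (hqf _ haA).2 ⟨u, huL⟩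
      simp only [t, qs, hk, dite_true, Fin.eta]
      change _ = ((c ((eq.symm k : T) : E) : ℝ) • ((eq.symm k : T) : E)) ⟨u, huL⟩
      rw [Pi.smul_apply, smul_eq_mul]
      congr 1
    rw [hcoord]
    have h1 : dist (sv ⟨u, huL⟩) (x ⟨u, huL⟩) ≤ dist sv x := dist_le_pi_dist sv x _
    rw [Real.dist_eq] at h1
    exact h1.trans hdist.le

end Literature.Analysis.Moments
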